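import Mathlib.Analysis.Complex.CauchyIntegral
import Mathlib.Analysis.Analytic.OfScalars
import Mathlib.Analysis.Analytic.ChangeOrigin
import Mathlib.Analysis.Analytic.IsolatedZeros
import Mathlib.Analysis.Analytic.Uniqueness
import Mathlib.Data.Fintype.Powerset
import Mathlib.Topology.Algebra.InfiniteSum.Real
import Mathlib.Tactic
import HarnessLib

/-!
# The Vivanti–Pringsheim theorem (segment form): power series with non-negative coefficients

**Vivanti–Pringsheim.** If `g(z) = Σ aₙ zⁿ` has non-negative real coefficients and finite radius
of convergence `R`, then `z = R` is a singular point of `g` [cite: Titchmarsh1939, §7.21 ("If `aₙ ≥ 0`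
for all values of `n`, then `z = 1` is a singular point" — with the radius of convergence normalised
to one, §7.2: "we can, of course, pass from this to the general case by a simple transformation")];
[cite: Remmert1991, Ch. 8 §1.4 (Vivanti–Pringsheim)].

We prove the form in which the theorem is USED to continue expansions along the real axis:
if `F : ℂ → ℂ` is analytic at every point of the real segment `[0, b)` and near `0⁺` it is the sum
of the series `Σ aₙ tⁿ` with `aₙ ≥ 0`, then `Σ aₙ tⁿ` converges (to `F t`) for every `t ∈ [0, b)`
(`summable_mul_pow_of_nonneg_of_analyticAt`, `hasSum_mul_pow_of_nonneg_of_analyticAt`).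

Proof (Titchmarsh's first proof in §7.21 — re-expansion at a real centre and a double series of
positive terms; Titchmarsh then gives "another proof, due to Pringsheim", which is NOT the one
formalised here): if the radius `R` were `< b`, re-expand at a real point `ρ₀ < R` close to `R`;
by Cauchy's theorem (Mathlib `DifferentiableOn.hasFPowerSeriesOnBall`) and uniqueness of Taylor
series the re-expansion converges on a disc of radius `δ > R - ρ₀`; its diagonal coefficients are
`Σ_l C(k+l,l) a_{k+l} ρ₀^l ≥ 0` (`hasSum_changeOrigin_ofScalars_apply`, the re-expansion formula for
`FormalMultilinearSeries.ofScalars`), so by Tonelli `Σ aₙ (ρ₀ + y)ⁿ < ∞` for some `ρ₀ + y > R`,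
a contradiction.

Also proved, as the tool it rests on: the explicit re-expansion (`changeOrigin`) coefficients of a
scalar power series (`changeOriginSeries_ofScalars_apply`, `hasSum_changeOrigin_ofScalars_apply`).

## References
* [Titchmarsh1939] E. C. Titchmarsh, *The Theory of Functions*, 2nd ed., Oxford 1939, §7.21.
* [Remmert1991] R. Remmert, *Theory of Complex Functions*, GTM 122, Springer 1991, Ch. 8 §1.
* Used by: pub-ising3d RECIPE R17 (radial-frame existence of conformal blocks from positivity;
  Hogervorst–Rychkov 2013 §3.1 argue exactly this way).
-/

noncomputable section

open Filter Metric Set Finset FormalMultilinearSeries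
open scoped Topology BigOperators NNReal ENNReal

namespace Literature.Analysis.Complex

/-! ### §1. Re-expansion coefficients of a scalar power series -/

section ChangeOriginOfScalars

variable (c : ℕ → ℂ)

/-- `ofScalars ℂ c n` evaluated on a vector taking the value `x` on `s` and `y` off `s` is
`c n · x^{#s} · y^{n - #s}`. [folklore] -/
theorem ofScalars_apply_piecewise (n : ℕ) (s : Finset (Fin n)) (x y : ℂ) :
    ofScalars ℂ c n (s.piecewise (fun _ => x) (fun _ => y)) = c n * (x ^ s.card * y ^ (n - s.card)) := by
  rw [ofScalars]
  simp only [_root_.smul_apply, ContinuousMultilinearMap.mkPiAlgebraFin_apply,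
    List.prod_ofFn, smul_eq_mul]
  congr 1
  rw [Finset.prod_piecewise, Finset.univ_inter, Finset.prod_const, Finset.prod_const]
  congr 2
  rw [← Finset.compl_eq_univ_sdiff, Finset.card_compl, Fintype.card_fin]

/-- The `(k,l)` re-expansion term of `ofScalars ℂ c` on constant vectors:
`changeOriginSeries k l (x,…,x) (y,…,y) = C(k+l,l) · c_{k+l} · x^l · y^k`. [folklore] -/
theorem changeOriginSeries_ofScalars_apply (k l : ℕ) (x y : ℂ) :
    (ofScalars ℂ c).changeOriginSeries k l (fun _ => x) (fun _ => y) =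
      ((k + l).choose l : ℂ) * c (k + l) * x ^ l * y ^ k := by
  rw [changeOriginSeries, _root_.sum_apply, _root_.sum_apply]
  have hterm : ∀ s : {s : Finset (Fin (k + l)) // s.card = l},
      (ofScalars ℂ c).changeOriginSeriesTerm k l s.1 s.2 (fun _ => x) (fun _ => y) =
        c (k + l) * x ^ l * y ^ k := by
    intro s
    rw [changeOriginSeriesTerm_apply, ofScalars_apply_piecewise, s.2, Nat.add_sub_cancel]
    ring
  rw [Finset.sum_congr rfl fun s _ => hterm s, Finset.sum_const, Finset.card_univ,
    Fintype.card_finset_len, Fintype.card_fin, nsmul_eq_mul]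
  ring

/-- **Re-expansion formula.** Inside the disc of convergence, the `k`-th Taylor coefficient of
`Σ cₙ zⁿ` at `x`, evaluated on `(y,…,y)`, is `Σ_l C(k+l,l) c_{k+l} x^l y^k`. [folklore] -/
theorem hasSum_changeOrigin_ofScalars_apply (k : ℕ) {x : ℂ}
    (hx : ‖x‖ₑ < (ofScalars ℂ c).radius) (y : ℂ) :
    HasSum (fun l : ℕ => ((k + l).choose l : ℂ) * c (k + l) * x ^ l * y ^ k)
      ((ofScalars ℂ c).changeOrigin x k (fun _ => y)) := by
  have hpos : 0 < (ofScalars ℂ c).radius := lt_of_le_of_lt (by simp) hx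
  have h1 := ((ofScalars ℂ c).hasFPowerSeriesOnBall_changeOrigin k hpos).hasSum
    (y := x) (mem_eball_zero_iff.mpr hx)
  rw [zero_add] at h1
  have h2 := ContinuousMultilinearMap.hasSum_eval h1 (fun _ => y)
  refine h2.congr_fun fun l => ?_
  exact (changeOriginSeries_ofScalars_apply c k l x y).symm

end ChangeOriginOfScalars

/-! ### §2. Auxiliary: real points accumulate in the punctured complex neighbourhood -/

/-- If a property holds at all real points of an interval `(t₀, t₀ + η)`, it holds frequently in
the punctured neighbourhood of `(t₀ : ℂ)`. [folklore] -/
theorem frequently_nhdsWithin_ne_of_forall_Ioo {P : ℂ → Prop} {t₀ η : ℝ} (hη : 0 < η)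
    (h : ∀ t : ℝ, t₀ < t → t < t₀ + η → P t) : ∃ᶠ z in 𝓝[≠] (t₀ : ℂ), P z := by
  -- the sequence `t₀ + η/(n+2)` tends to `t₀` within `{t₀}ᶜ`
  have hut : Tendsto (fun n : ℕ => ((t₀ + η / ((n : ℝ) + 2) : ℝ) : ℂ)) atTop (𝓝[≠] (t₀ : ℂ)) := by
    refine tendsto_nhdsWithin_iff.mpr ⟨?_, Eventually.of_forall fun n => ?_⟩
    · have h0 : Tendsto (fun n : ℕ => t₀ + η / ((n : ℝ) + 2)) atTop (𝓝 (t₀ + 0)) := by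
        refine tendsto_const_nhds.add ?_
        refine Tendsto.div_atTop tendsto_const_nhds ?_
        exact tendsto_atTop_add_const_right _ _ tendsto_natCast_atTop_atTop
      rw [add_zero] at h0
      exact (Complex.continuous_ofReal.tendsto t₀).comp h0
    · rw [mem_compl_iff, mem_singleton_iff, Complex.ofReal_inj]
      have : 0 < η / ((n : ℝ) + 2) := by positivity
      linarith
  have hall : ∀ n : ℕ, P (((t₀ + η / ((n : ℝ) + 2) : ℝ) : ℂ)) := fun n => by
    have h2 : (0 : ℝ) < (n : ℝ) + 2 := by positivity
    refine h _ (by have := div_pos hη h2; linarith) ?_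
    have : η / ((n : ℝ) + 2) < η := by
      rw [div_lt_iff₀ h2]; nlinarith
    linarith
  exact hut.frequently (Frequently.of_forall hall)

/-! ### §3. The Vivanti–Pringsheim theorem along a real segment -/

section Pringsheim

variable {a : ℕ → ℝ} {F : ℂ → ℂ} {b ε : ℝ}

/-! Throughout, the series `Σ aₙ zⁿ` with real coefficients is the formal multilinear series
`ofScalars ℂ (fun n => (a n : ℂ))` over `ℂ` (no new definition is introduced). -/

/-- The `n`-th term of `Σ aₙ zⁿ` on the constant vector `(z,…,z)` is `aₙ zⁿ`. [folklore] -/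
theorem ofScalars_ofReal_apply (a : ℕ → ℝ) (z : ℂ) (n : ℕ) :
    ofScalars ℂ (fun n => (a n : ℂ)) n (fun _ => z) = (a n : ℂ) * z ^ n := by
  rw [ofScalars_apply_eq, smul_eq_mul]

/-- For `aₙ ≥ 0` the operator norm of the `n`-th term is `aₙ`. [folklore] -/
theorem norm_ofScalars_ofReal (ha : ∀ n, 0 ≤ a n) (n : ℕ) :
    ‖ofScalars ℂ (fun n => (a n : ℂ)) n‖ = a n := by
  rw [ofScalars_norm, Complex.norm_real, Real.norm_of_nonneg (ha n)]

/-- The extended norm of a real number viewed in `ℂ`. [folklore] -/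
theorem enorm_ofReal_eq (s : ℝ) : ‖(s : ℂ)‖ₑ = ENNReal.ofReal |s| := by
  rw [enorm_eq_nnnorm, Complex.nnnorm_real, ← enorm_eq_nnnorm, Real.enorm_eq_ofReal_abs]

/-- Inside the radius the real series converges. [folklore] -/
theorem summable_of_ofReal_lt_radius (ha : ∀ n, 0 ≤ a n) {t : ℝ} (ht0 : 0 ≤ t)
    (ht : ENNReal.ofReal t < (ofScalars ℂ (fun n => (a n : ℂ))).radius) : Summable fun n => a n * t ^ n := by
  have h := (ofScalars ℂ (fun n => (a n : ℂ))).summable_norm_mul_pow (r := t.toNNReal) ht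
  simp only [Real.coe_toNNReal _ ht0, norm_ofScalars_ofReal ha] at h
  exact h

/-- A real point of convergence lies in the closed disc of convergence. [folklore] -/
theorem ofReal_le_radius_of_summable (ha : ∀ n, 0 ≤ a n) {t : ℝ} (ht0 : 0 ≤ t)
    (hs : Summable fun n => a n * t ^ n) : ENNReal.ofReal t ≤ (ofScalars ℂ (fun n => (a n : ℂ))).radius := by
  refine (ofScalars ℂ (fun n => (a n : ℂ))).le_radius_of_summable (r := t.toNNReal) ?_
  simp only [Real.coe_toNNReal _ ht0, norm_ofScalars_ofReal ha]
  exact hs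

/-- The sum function of the series at a real point inside the radius. [folklore] -/
theorem hasSum_ofScalars_ofReal_sum {t : ℝ} (ht0 : 0 ≤ t)
    (ht : ENNReal.ofReal t < (ofScalars ℂ (fun n => (a n : ℂ))).radius) :
    HasSum (fun n => (a n : ℂ) * (t : ℂ) ^ n) ((ofScalars ℂ (fun n => (a n : ℂ))).sum t) := by
  have hmem : (t : ℂ) ∈ Metric.eball (0 : ℂ) (ofScalars ℂ (fun n => (a n : ℂ))).radius := by
    rw [mem_eball_zero_iff, enorm_ofReal_eq, abs_of_nonneg ht0]
    exact ht
  have h := ((ofScalars ℂ (fun n => (a n : ℂ))).hasFPowerSeriesOnBall (lt_of_le_of_lt (by simp) ht)).hasSum hmem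
  rw [zero_add] at h
  simpa only [ofScalars_ofReal_apply] using h

/-- The sum function is analytic at real points strictly inside the radius. [folklore] -/
theorem analyticAt_ofScalars_ofReal_sum {s : ℝ}
    (hs : ENNReal.ofReal |s| < (ofScalars ℂ (fun n => (a n : ℂ))).radius) :
    AnalyticAt ℂ (ofScalars ℂ (fun n => (a n : ℂ))).sum s := by
  refine ((ofScalars ℂ (fun n => (a n : ℂ))).hasFPowerSeriesOnBall (lt_of_le_of_lt (by simp) hs)).analyticAt_of_mem ?_
  rw [mem_eball_zero_iff, enorm_ofReal_eq]
  exact hs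

/-- **Identity theorem on a real segment.** If `F` is analytic at the points of `[0, b)`, agrees with
`Σ aₙ tⁿ` on `(0, ε)`, and `0 < R₁ < b` lies strictly inside the radius, then `F` equals the sum
function on the segment `[0, R₁]`. [folklore] -/
theorem eqOn_segment_ofScalars_ofReal_sum
    (hF : ∀ t : ℝ, 0 ≤ t → t < b → AnalyticAt ℂ F t) (hε : 0 < ε)
    (hgerm : ∀ t : ℝ, 0 < t → t < ε → HasSum (fun n => (a n : ℂ) * (t : ℂ) ^ n) (F t))
    {R₁ : ℝ} (hR₁0 : 0 < R₁) (hR₁b : R₁ < b)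
    (hR₁rad : ENNReal.ofReal R₁ < (ofScalars ℂ (fun n => (a n : ℂ))).radius) :
    EqOn F (ofScalars ℂ (fun n => (a n : ℂ))).sum (((↑) : ℝ → ℂ) '' Icc 0 R₁) := by
  have hSg_conn : IsPreconnected (((↑) : ℝ → ℂ) '' Icc 0 R₁) :=
    isPreconnected_Icc.image _ Complex.continuous_ofReal.continuousOn
  have hF_Sg : AnalyticOnNhd ℂ F (((↑) : ℝ → ℂ) '' Icc 0 R₁) := by
    rintro z ⟨s, ⟨hs0, hs1⟩, rfl⟩
    exact hF s hs0 (by linarith)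
  have hg_Sg : AnalyticOnNhd ℂ (ofScalars ℂ (fun n => (a n : ℂ))).sum (((↑) : ℝ → ℂ) '' Icc 0 R₁) := by
    rintro z ⟨s, ⟨hs0, hs1⟩, rfl⟩
    refine analyticAt_ofScalars_ofReal_sum (lt_of_le_of_lt ?_ hR₁rad)
    rw [abs_of_nonneg hs0]
    exact ENNReal.ofReal_le_ofReal hs1
  -- base point `e/2`, `e = min (ε/2) (R₁/2)`; agreement on `(0, e)`
  set e : ℝ := min (ε / 2) (R₁ / 2) with he
  have he0 : 0 < e := lt_min (by linarith) (by linarith)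
  have heε : e < ε := lt_of_le_of_lt (min_le_left _ _) (by linarith)
  have heR : e < R₁ := lt_of_le_of_lt (min_le_right _ _) (by linarith)
  have hz₀mem : ((e / 2 : ℝ) : ℂ) ∈ ((↑) : ℝ → ℂ) '' Icc 0 R₁ :=
    ⟨e / 2, ⟨by linarith, by linarith⟩, rfl⟩
  have hagree : ∀ s : ℝ, 0 < s → s < e → F s = (ofScalars ℂ (fun n => (a n : ℂ))).sum s := by
    intro s hs0 hse
    have h1 := hgerm s hs0 (lt_trans hse heε)
    have hs_rad : ENNReal.ofReal s < (ofScalars ℂ (fun n => (a n : ℂ))).radius :=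
      lt_of_le_of_lt (ENNReal.ofReal_le_ofReal (by linarith)) hR₁rad
    exact h1.unique (hasSum_ofScalars_ofReal_sum hs0.le hs_rad)
  have hfreq : ∃ᶠ z in 𝓝[≠] (((e / 2 : ℝ)) : ℂ), F z = (ofScalars ℂ (fun n => (a n : ℂ))).sum z := by
    refine frequently_nhdsWithin_ne_of_forall_Ioo (η := e / 2) (by linarith) fun s hs1 hs2 => ?_
    exact hagree s (by linarith) (by linarith)
  exact hF_Sg.eqOn_of_preconnected_of_frequently_eq hg_Sg hSg_conn hz₀mem hfreq

/-- **Tonelli step.** If `Σ_k Q_k(y)` converges, where `Q = changeOrigin ρ₀` of `Σ aₙ zⁿ`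
(`aₙ ≥ 0`, `0 ≤ ρ₀` inside the radius, `0 ≤ y`), then `Σ aₙ (ρ₀ + y)ⁿ` converges. [folklore] -/
theorem summable_mul_add_pow_of_summable_changeOrigin (ha : ∀ n, 0 ≤ a n) {ρ₀ y : ℝ}
    (hρ₀ : 0 ≤ ρ₀) (hy : 0 ≤ y) (hrad : ‖(ρ₀ : ℂ)‖ₑ < (ofScalars ℂ (fun n => (a n : ℂ))).radius)
    (hQ : Summable fun k : ℕ => (ofScalars ℂ (fun n => (a n : ℂ))).changeOrigin (ρ₀ : ℂ) k fun _ => (y : ℂ)) :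
    Summable fun n => a n * (ρ₀ + y) ^ n := by
  -- the terms, as real numbers: `T (k,l) = C(k+l,l) a_{k+l} ρ₀^l y^k ≥ 0`
  set T : ℕ × ℕ → ℝ := fun kl => ((kl.1 + kl.2).choose kl.2 : ℝ) * a (kl.1 + kl.2) *
    ρ₀ ^ kl.2 * y ^ kl.1 with hT
  have hT_nonneg : ∀ kl, 0 ≤ T kl := fun kl => by
    have := ha (kl.1 + kl.2)
    positivity
  have hT_inner : ∀ k : ℕ, HasSum (fun l => T (k, l))
      ((ofScalars ℂ (fun n => (a n : ℂ))).changeOrigin (ρ₀ : ℂ) k fun _ => (y : ℂ)).re := by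
    intro k
    have h := hasSum_changeOrigin_ofScalars_apply (fun n => (a n : ℂ)) k hrad (y : ℂ)
    have h' := Complex.hasSum_re h
    refine h'.congr_fun fun l => ?_
    have hc : ((k + l).choose l : ℂ) * (a (k + l) : ℂ) * (ρ₀ : ℂ) ^ l * (y : ℂ) ^ k =
        ((T (k, l) : ℝ) : ℂ) := by
      simp only [hT]
      push_cast
      ring
    rw [hc, Complex.ofReal_re]
  have hT_summable : Summable T := by
    refine (summable_prod_of_nonneg hT_nonneg).mpr ⟨fun k => (hT_inner k).summable, ?_⟩
    have : (fun k => ∑' l, T (k, l)) =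
        fun k => ((ofScalars ℂ (fun n => (a n : ℂ))).changeOrigin (ρ₀ : ℂ) k fun _ => (y : ℂ)).re := by
      funext k; exact (hT_inner k).tsum_eq
    rw [this]
    exact Complex.reCLM.summable hQ
  -- the partial sums of `Σ aₙ (ρ₀+y)ⁿ` are bounded by `Σ T`
  have hbound : ∀ N : ℕ, ∑ n ∈ Finset.range N, a n * (ρ₀ + y) ^ n ≤ ∑' kl, T kl := by
    intro N
    have hstep : ∀ n : ℕ, a n * (ρ₀ + y) ^ n =
        ∑ ij ∈ Finset.antidiagonal n, T (ij.2, ij.1) := by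
      intro n
      rw [add_pow, Finset.mul_sum, Finset.Nat.sum_antidiagonal_eq_sum_range_succ_mk]
      refine Finset.sum_congr rfl fun m hm => ?_
      have hmn : m ≤ n := Nat.lt_succ_iff.mp (Finset.mem_range.mp hm)
      simp only [hT]
      rw [show n - m + m = n from Nat.sub_add_cancel hmn]
      ring
    rw [Finset.sum_congr rfl fun n _ => hstep n, ← Finset.sum_biUnion]
    · rw [show (∑ x ∈ (Finset.range N).biUnion Finset.antidiagonal, T (x.2, x.1)) =
          ∑ x ∈ ((Finset.range N).biUnion Finset.antidiagonal).map
            (Equiv.prodComm ℕ ℕ).toEmbedding, T x by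
        rw [Finset.sum_map]; rfl]
      exact hT_summable.sum_le_tsum _ fun kl _ => hT_nonneg kl
    · intro n _ m _ hnm
      change Disjoint (Finset.antidiagonal n) (Finset.antidiagonal m)
      exact Finset.disjoint_left.mpr fun ij hn hm' => hnm (by
        rw [Finset.mem_antidiagonal] at hn hm'
        rw [← hn, ← hm'])
  exact summable_of_sum_range_le
    (fun n => mul_nonneg (ha n) (pow_nonneg (by linarith) n)) hbound

/-- **Vivanti–Pringsheim (segment form): summability.** Let `aₙ ≥ 0`, let `F : ℂ → ℂ` be
analytic at every point of the real segment `[0, b)`, and suppose `F(t) = Σ aₙ tⁿ` for real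
`t ∈ (0, ε)`. Then `Σ aₙ tⁿ` converges for every `t ∈ [0, b)`.
[cite: Titchmarsh1939, §7.21] -/
theorem summable_mul_pow_of_nonneg_of_analyticAt (ha : ∀ n, 0 ≤ a n)
    (hF : ∀ t : ℝ, 0 ≤ t → t < b → AnalyticAt ℂ F t) (hε : 0 < ε)
    (hgerm : ∀ t : ℝ, 0 < t → t < ε → HasSum (fun n => (a n : ℂ) * (t : ℂ) ^ n) (F t))
    {t : ℝ} (ht0 : 0 ≤ t) (htb : t < b) : Summable fun n => a n * t ^ n := by
  by_contra hnot
  -- (1) the radius is positive: the series converges at `e = ε/2`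
  have hsum_e : Summable fun n => a n * (ε / 2) ^ n := by
    have h := (hgerm (ε / 2) (by linarith) (by linarith)).summable
    have h' : Summable fun n => ((a n * (ε / 2) ^ n : ℝ) : ℂ) := by
      simpa [Complex.ofReal_mul, Complex.ofReal_pow] using h
    exact Complex.summable_ofReal.mp h'
  have he_rad : ENNReal.ofReal (ε / 2) ≤ (ofScalars ℂ (fun n => (a n : ℂ))).radius :=
    ofReal_le_radius_of_summable ha (by linarith) hsum_e
  -- (2) the radius is `≤ t`, hence finite: `radius = ofReal R` with `ε/2 ≤ R ≤ t < b`
  have hrad_le_t : (ofScalars ℂ (fun n => (a n : ℂ))).radius ≤ ENNReal.ofReal t := by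
    by_contra hlt
    exact hnot (summable_of_ofReal_lt_radius ha ht0 (not_le.mp hlt))
  have hrad_ne_top : (ofScalars ℂ (fun n => (a n : ℂ))).radius ≠ ∞ :=
    ne_top_of_le_ne_top ENNReal.ofReal_ne_top hrad_le_t
  set R : ℝ := (ofScalars ℂ (fun n => (a n : ℂ))).radius.toReal with hRdef
  have hRrad : (ofScalars ℂ (fun n => (a n : ℂ))).radius = ENNReal.ofReal R := by
    rw [hRdef, ENNReal.ofReal_toReal hrad_ne_top]
  have heR : ε / 2 ≤ R := by
    have h := he_rad
    rw [hRrad] at h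
    exact (ENNReal.ofReal_le_ofReal_iff ENNReal.toReal_nonneg).mp h
  have hR0 : 0 < R := by linarith
  have hRt : R ≤ t := by
    have h := hrad_le_t
    rw [hRrad] at h
    exact (ENNReal.ofReal_le_ofReal_iff ht0).mp h
  have hRb : R < b := lt_of_le_of_lt hRt htb
  -- (3) `F` is analytic on a ball around the real point `R`
  obtain ⟨δ₀, hδ₀, hanal⟩ := (hF R hR0.le hRb).exists_ball_analyticOnNhd
  set δ : ℝ := min δ₀ R with hδdef
  have hδ : 0 < δ := lt_min hδ₀ hR0
  have hδ₀' : δ ≤ δ₀ := min_le_left _ _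
  have hδR : δ ≤ R := min_le_right _ _
  -- the re-expansion point `ρ₀ = R - δ/4`, the Cauchy radius `δ/2` and the step `y = 3δ/8`
  set ρ₀ : ℝ := R - δ / 4 with hρ₀
  have hρ₀0 : 0 ≤ ρ₀ := by rw [hρ₀]; linarith
  have hρ₀R : ρ₀ < R := by rw [hρ₀]; linarith
  set y : ℝ := 3 * δ / 8 with hy
  have hy0 : 0 < y := by rw [hy]; linarith
  have hyδ : y < δ / 2 := by rw [hy]; linarith
  have hρy : R < ρ₀ + y := by rw [hρ₀, hy]; linarith
  have hρ₀_rad : ‖(ρ₀ : ℂ)‖ₑ < (ofScalars ℂ (fun n => (a n : ℂ))).radius := by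
    rw [enorm_ofReal_eq, abs_of_nonneg hρ₀0, hRrad]
    exact (ENNReal.ofReal_lt_ofReal_iff hR0).mpr hρ₀R
  -- (4) Cauchy: `F` has a power series on the ball `B(ρ₀, δ/2)`
  have hδ2 : 0 < δ / 2 := by linarith
  set δn : ℝ≥0 := ⟨δ / 2, hδ2.le⟩ with hδn
  have hδn_coe : (δn : ℝ≥0∞) = ENNReal.ofReal (δ / 2) := (ENNReal.ofReal_eq_coe_nnreal hδ2.le).symm
  have hδn_pos : 0 < δn := by
    rw [← NNReal.coe_lt_coe, NNReal.coe_zero]; exact hδ2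
  have hsub : closedBall (ρ₀ : ℂ) δn ⊆ ball (R : ℂ) δ₀ := by
    intro z hz
    rw [mem_closedBall] at hz
    have hz' : dist z (ρ₀ : ℂ) ≤ δ / 2 := hz
    rw [mem_ball]
    have hdist : dist (ρ₀ : ℂ) (R : ℂ) = R - ρ₀ := by
      rw [Complex.dist_eq, ← Complex.ofReal_sub, Complex.norm_real, Real.norm_eq_abs,
        abs_of_nonpos (by linarith)]
      ring
    calc dist z (R : ℂ) ≤ dist z (ρ₀ : ℂ) + dist (ρ₀ : ℂ) (R : ℂ) := dist_triangle _ _ _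
      _ ≤ δ / 2 + (R - ρ₀) := by rw [hdist]; linarith
      _ < δ₀ := by rw [hρ₀]; linarith
  have hcauchy : HasFPowerSeriesOnBall F (cauchyPowerSeries F (ρ₀ : ℂ) δn) (ρ₀ : ℂ) δn :=
    (hanal.differentiableOn.mono hsub).hasFPowerSeriesOnBall hδn_pos
  -- (5) the germ at `ρ₀`: `F = series sum` on the segment `[0, R₁]`, `R₁ = (ρ₀ + R)/2`
  set R₁ : ℝ := (ρ₀ + R) / 2 with hR₁
  have hR₁R : R₁ < R := by rw [hR₁]; linarith
  have hρ₀R₁ : ρ₀ < R₁ := by rw [hR₁]; linarith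
  have hR₁0 : 0 < R₁ := by linarith
  have hR₁rad : ENNReal.ofReal R₁ < (ofScalars ℂ (fun n => (a n : ℂ))).radius := by
    rw [hRrad]; exact (ENNReal.ofReal_lt_ofReal_iff hR0).mpr hR₁R
  have hEqOn := eqOn_segment_ofScalars_ofReal_sum hF hε hgerm hR₁0 (by linarith) hR₁rad
  have hF_ρ₀ : AnalyticAt ℂ F ρ₀ := hF ρ₀ hρ₀0 (by linarith)
  have hg_ρ₀ : AnalyticAt ℂ (ofScalars ℂ (fun n => (a n : ℂ))).sum ρ₀ := by
    refine analyticAt_ofScalars_ofReal_sum ?_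
    rw [abs_of_nonneg hρ₀0, hRrad]
    exact (ENNReal.ofReal_lt_ofReal_iff hR0).mpr hρ₀R
  have hev : ∀ᶠ z in 𝓝 (ρ₀ : ℂ), F z = (ofScalars ℂ (fun n => (a n : ℂ))).sum z := by
    refine (hF_ρ₀.frequently_eq_iff_eventually_eq hg_ρ₀).mp ?_
    refine frequently_nhdsWithin_ne_of_forall_Ioo (η := R₁ - ρ₀) (by linarith) fun s hs1 hs2 => ?_
    exact hEqOn ⟨s, ⟨by linarith, by linarith⟩, rfl⟩
  -- (6) the Taylor series of `F` at `ρ₀` is the re-expansion, and it converges on `B(ρ₀, δ)`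
  have hρ₀_rad' : (‖(ρ₀ : ℂ)‖₊ : ℝ≥0∞) < (ofScalars ℂ (fun n => (a n : ℂ))).radius := by
    rw [← enorm_eq_nnnorm]; exact hρ₀_rad
  have hchange : HasFPowerSeriesOnBall (ofScalars ℂ (fun n => (a n : ℂ))).sum
      ((ofScalars ℂ (fun n => (a n : ℂ))).changeOrigin (ρ₀ : ℂ)) (ρ₀ : ℂ)
      ((ofScalars ℂ (fun n => (a n : ℂ))).radius - ‖(ρ₀ : ℂ)‖₊) := by
    have hpball := (ofScalars ℂ (fun n => (a n : ℂ))).hasFPowerSeriesOnBall (lt_of_le_of_lt (by simp) hρ₀_rad)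
    have := hpball.changeOrigin hρ₀_rad'
    rwa [zero_add] at this
  have hFchange : HasFPowerSeriesAt F ((ofScalars ℂ (fun n => (a n : ℂ))).changeOrigin (ρ₀ : ℂ)) (ρ₀ : ℂ) :=
    hchange.hasFPowerSeriesAt.congr (hev.mono fun z hz => hz.symm)
  have hseries_eq : cauchyPowerSeries F (ρ₀ : ℂ) δn = (ofScalars ℂ (fun n => (a n : ℂ))).changeOrigin (ρ₀ : ℂ) :=
    hcauchy.hasFPowerSeriesAt.eq_formalMultilinearSeries hFchange
  rw [hseries_eq] at hcauchy
  -- (7) summing the re-expansion at the real point `y < δ` and Tonelli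
  have hymem : (y : ℂ) ∈ Metric.eball (0 : ℂ) δn := by
    rw [mem_eball_zero_iff, enorm_ofReal_eq, abs_of_nonneg hy0.le, hδn_coe]
    exact (ENNReal.ofReal_lt_ofReal_iff hδ2).mpr hyδ
  have hsumQ : Summable fun k : ℕ =>
      (ofScalars ℂ (fun n => (a n : ℂ))).changeOrigin (ρ₀ : ℂ) k fun _ => (y : ℂ) :=
    (hcauchy.hasSum hymem).summable
  have hsum_big : Summable fun n => a n * (ρ₀ + y) ^ n :=
    summable_mul_add_pow_of_summable_changeOrigin ha hρ₀0 hy0.le hρ₀_rad hsumQ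
  -- (8) contradiction with the radius
  have hle := ofReal_le_radius_of_summable ha (by linarith) hsum_big
  rw [hRrad] at hle
  have := (ENNReal.ofReal_le_ofReal_iff hR0.le).mp hle
  linarith

/-- **Vivanti–Pringsheim (segment form): the value.** Under the same hypotheses the series sums
to `F t` at every real `t ∈ (0, b)`: the expansion valid near `0⁺` remains valid along the whole
segment of analyticity. [cite: Titchmarsh1939, §7.21] -/
theorem hasSum_mul_pow_of_nonneg_of_analyticAt (ha : ∀ n, 0 ≤ a n)
    (hF : ∀ t : ℝ, 0 ≤ t → t < b → AnalyticAt ℂ F t) (hε : 0 < ε)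
    (hgerm : ∀ t : ℝ, 0 < t → t < ε → HasSum (fun n => (a n : ℂ) * (t : ℂ) ^ n) (F t))
    {t : ℝ} (ht0 : 0 < t) (htb : t < b) : HasSum (fun n => (a n : ℂ) * (t : ℂ) ^ n) (F t) := by
  -- a slightly larger real point `t' ∈ (t, b)` is still a point of convergence
  set t' : ℝ := (t + b) / 2 with ht'
  have htt' : t < t' := by rw [ht']; linarith
  have ht'b : t' < b := by rw [ht']; linarith
  have ht'0 : 0 < t' := by linarith
  have hs' := summable_mul_pow_of_nonneg_of_analyticAt ha hF hε hgerm ht'0.le ht'b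
  have hrad : ENNReal.ofReal t' ≤ (ofScalars ℂ (fun n => (a n : ℂ))).radius :=
    ofReal_le_radius_of_summable ha ht'0.le hs'
  -- identity theorem on the segment `[0, (t+t')/2]`
  set R₁ : ℝ := (t + t') / 2 with hR₁
  have hR₁t' : R₁ < t' := by rw [hR₁]; linarith
  have htR₁ : t < R₁ := by rw [hR₁]; linarith
  have hR₁rad : ENNReal.ofReal R₁ < (ofScalars ℂ (fun n => (a n : ℂ))).radius :=
    lt_of_lt_of_le ((ENNReal.ofReal_lt_ofReal_iff ht'0).mpr hR₁t') hrad
  have hEqOn := eqOn_segment_ofScalars_ofReal_sum hF hε hgerm (by linarith) (by linarith) hR₁rad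
  have hFt : F t = (ofScalars ℂ (fun n => (a n : ℂ))).sum t := hEqOn ⟨t, ⟨ht0.le, htR₁.le⟩, rfl⟩
  rw [hFt]
  exact hasSum_ofScalars_ofReal_sum ht0.le
    (lt_of_le_of_lt (ENNReal.ofReal_le_ofReal htR₁.le) hR₁rad)

end Pringsheim

end Literature.Analysis.Complex

end
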